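import Summits.BirchSwinnertonDyer.BirchSwinnertonDyer.Theses.TwoAdicConverse
import Summits.BirchSwinnertonDyer.BirchSwinnertonDyer.Theorems.CongruentShaFreeCutKatoZetaRoadReadings
import Summits.BirchSwinnertonDyer.BirchSwinnertonDyer.Theorems.CongruentShaFreeCutKatoDescentDatumOfH2RankOne
import Literature.NumberTheory.EllipticCurves.BSDSelmerCMPConverseKatoDescentProofs
import Literature.NumberTheory.EllipticCurves.Kato2004.IwasawaH2DescentFiniteSelmer
import HarnessLib

/-!
# Route `TwoAdicConverse`: the Kato–zeta road to the rank-`0` `2`-converse (items 19219 / 19218) on the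
# PINNED Kato descent datum — readings (R) and (K) DISCHARGED by Kato's construction facts, the research
# content isolated as ONE ∀-statement over pinned data: the vanishing reading (VAN)

WHAT IS PROVED (seat bsd-2adic-conv-2 GEN 10, D-0074 (A) «find: 19219 MultiplicativeRankZeroTwoConverse
likewise»; THEOREMS ONLY — no definition, no named fact, nothing asserted; BSD is not advanced).

GEN 2 of this seat (`Theorems/TwoAdicConverseKatoZetaRoad.lean`, p422516) typed the Burungale–Tian road
(Ann. of Math. 203 (2026) Thm. 3.1 + Remark 3.2) over bsd-potss's ABSTRACT interface
`Rank1Residual.Additive.KatoDescentDatum p` with a FREE interface predicate `IsOf`, displaying four ∀-schemata: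
(R) «a datum exists», (3.1) «`Sel_{2^∞}` finite ⟹ `H2/T·H2` finite», (VAN) «`Sel_{2^∞}` finite ∧ `L(E,1) = 0`
⟹ `ι[z]` torsion», (MC) «Conj. 12.10 ⊗ ℚ₂ at the datum». The planner (bsd-2adic-plan g13, 04:28/04:54Z,
TARGET RC-31) wished to re-split BOTH rank-`0` parents of S3 onto ONE shared reduction-type-free object on that
road, but DEFERRED it: over a free `IsOf` the object would be «smuggled existence».

Since then three other cells PINNED the interface to real objects: bsd-smallim's
`Kato2004.IwasawaH1Data` (`𝐇¹_Γ(T_pW)` levelwise on the tree's continuous cohomology; facts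
`nonempty_iwasawaH1Data`, `thm12_4`), bsd-cn100-ty's `Kato2004.IwasawaH2Data` (`𝐇²_Γ` with (14.14.1),
`A = H¹(ℤ[1/p], T_pW)` and `ι = proj₀` pinned; fact `nonempty_iwasawaH2Data`), and bsd-cn100's v2 pin
`IsKatoDescentDatumOfH2 W p D` (`Theorems/CongruentShaFreeCutKatoDescentDatumOfH2.lean`) with the theorems
`exists_isKatoDescentDatumOfH2` (reading (R) ⟸ the three construction facts) and — decisive here —
`CongruentShaFreeCutKatoZetaRoadReadings.readingRK_of_facts'`: for EVERY `W` and `p` a v2-pinned datum whose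
`z` satisfies the main-conjecture-TYPE relation `∃ a b, (p^a)·char H2 = (p^b)·char(H/Λz)` EXISTS, by MODULE
ALGEBRA (the pin leaves `z` free; `𝐇¹_Γ` is an ideal of finite index in `Λ`). So on the pin, (R) AND (K) are
theorems modulo construction facts, and the research content of the road is NOT «12.10 at every pinned
datum» (FALSE: `z ↦ T·z` breaks it) but the VANISHING READING on pinned data WITH (K):

  (VAN-K)  for every v2-pinned datum `D` of `T₂E` with `∃ a b, (2^a)·char D.H2 = (2^b)·char(D.H/Λ D.z)`:
           `Sel_{2^∞}(E/ℚ)` finite ∧ `L(E,1) = 0` ⟹ `ι[D.z]` is `ℤ₂`-torsion in `H¹(ℤ[1/2], T₂E)`.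

For Kato's GENUINE zeta element this is PRINT (explicit reciprocity law Thm. 12.5 (1) + `H¹(ℚ_ℓ, V) = 0` +
`H¹_f(ℚ, V) = 0`, the source's (3.3)); for a pinned `z` with (K) it follows from that print plus Kato's Main
Conjecture 12.10 in `Λ ⊗ ℚ₂` at `(T)` (which forces `z ∈ 2^ℤ·Λˣ·𝐳` up to a factor non-vanishing at `T = 0`).
So (VAN-K) is the road's ONE research object, reduction-type-free and `E[2]`-free; this file proves
(§2) «construction facts ∧ (3.1) at `2` ∧ (VAN-K) on the branch ⟹ the crux» for 19219, 19218, both at once,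
and the reduction-type-free statement. The Theses-free CARRIER naming (VAN-K) as a `Prop` and the glue
theorems BY NAME are the companion `Theorems/TwoAdicConverseKatoZetaDefs.lean` (planner's RC-31 (1)(2)).

* §1 `analyticRank_eq_zero_of_pinH2` — B–T Thm. 3.1 on ONE v2 pin: (3.1) stated on the PINNED descent
  cokernel `H¹(ℤ[1/p],T_pW)/proj₀(𝐇¹_Γ/T)` (`IwasawaH1Data.descentCokernel`, exactly the object of the
  accepted rank-one fact `Kato2004.finite_descentCokernel_of_rankOne`), transported by (14.14.1)
  (`KatoDescentDatumPinH2.finite_coinvariants_H2_iff_finite_descentCokernel`); any `W`, any `p`; the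
  `Λ`-module step is GEN 2's `KatoZeta.forall_pow_smul_iota_zeta_ne_zero` re-proved on the pin (this file imports the
  route file and Theses-free modules only).
* §2 the ∀-closed bridges at `p = 2`: `multiplicativeRankZeroTwoConverse_of_vanK` (item 19219),
  `goodOrdinaryRankZeroTwoConverse_of_vanK` (item 19218), `nonCM_rankZero_twoConverse_of_vanK`
  (every non-CM `E/ℚ`, any reduction at `2`), `rankZero_twoConverse_cruxes_of_vanK` (both cruxes).
  Displayed inputs: CONSTRUCTION facts {`nonempty_iwasawaH1Data`, `nonempty_iwasawaH2Data`, `thm12_4`}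
  [Kato (12.2.1), Thm. 12.4 (1)(2), (14.14.1); `p = 2` included]; PRINT reading (3.1) at `p = 2` on pinned
  objects [Kato (14.9.3) "exact up to ×2 in the case p = 2" (ranks unaffected) + (14.14.1)–(14.14.2), Kato's
  own pattern 14.13; the rank-`0` twin of `finite_descentCokernel_of_rankOne`]; RESEARCH (VAN-K).
  No `p`-adic `L`-function, no A235/A236, no Greenberg–Stevens/𝓛, no period, no K11, no modularity display
  (a newform is implicit in Thm. 12.4's `f`), no split/non-split or ordinary/supersingular distinction.

HONEST STATUS: (VAN-K) at `p = 2` for non-CM `E` is OPEN (Burungale–Tian p. 3: «it is natural to seek the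
rank zero 2-converse for non-CM curves … instances of Kato's main conjecture for 2-ordinary non-CM curves»);
modulo print it is EQUIVALENT to the rank-`0` `2`-converse itself (GEN 0's circularity principle); nothing is
booked; a closed 19219 would close a rung leaf («closes rung S3 of BirchSwinnertonDyer»), never the summit.
PARTITION: none — RANK axis (S3, both rank-`0` cruxes 19218/19219); companion formula cell X5@2 (B1·O1).

References: [BurungaleTian2026] Thm. 3.1 (proof p. 6: (3.1)–(3.3)), Remark 3.2, §1.0.3 (p. 3);
[Kato2004Asterisque] §12.2 (12.2.1) (p. 220), Thm. 12.4 (p. 221), Thm. 12.5 (1) (p. 222), Conj. 12.10 (p. 224),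
§14.9 (14.9.3) (p. 240), 14.13 and §14.14 (14.14.1)–(14.14.2) (p. 243); [AlpogeBhargavaShnidman2022] App. A §10.1.1.
-/

set_option autoImplicit false
set_option linter.dupNamespace false

noncomputable section

open scoped Classical

open WeierstrassCurve Field Literature.NumberTheory.EllipticCurves
  Literature.NumberTheory.EllipticCurves.Kato2004 Literature.NumberTheory.EllipticCurves.IwasawaAlgebra
  Literature.NumberTheory.EllipticCurves.Kato2004.EulerSystemValues
  Literature.NumberTheory.GaloisRepresentations
  Literature.NumberTheory.EllipticCurves.Rank1Residual
  Summit.BirchSwinnertonDyer.Rank1Residual.Additive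
  Summit.BirchSwinnertonDyer.BirchSwinnertonDyer.Theorems.CongruentShaFreeCutKatoDescentDatumOfH2
  Summit.BirchSwinnertonDyer.BirchSwinnertonDyer.Theorems.CongruentShaFreeCutKatoZetaRoadReadings

namespace Summit.BirchSwinnertonDyer.BirchSwinnertonDyer.Theorems.TwoAdicKatoZetaPinned

/-! ## §1 Burungale–Tian Thm. 3.1 on ONE v2-pinned datum, (3.1) read on the pinned descent cokernel -/

section OnePin

variable (W : WeierstrassCurve ℚ) [W.IsElliptic] (p : ℕ) [Fact p.Prime]
  [ContinuousSMul ℤ_[p] (W.tateModule p)] {D : KatoDescentDatum p}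

/-- **Burungale–Tian's `Λ`-module step on a v2-PINNED Kato descent datum** (the source's (3.1)–(3.2) and the
sentence after (3.2)): if `D.z` satisfies the main-conjecture-type relation (K)
`(p^a)·char_Λ D.H2 = (p^b)·char_Λ (D.H/Λ D.z)` and the PINNED descent cokernel
`H¹(ℤ[1/p], T_pW)/proj₀(𝐇¹_Γ/T)` is finite (equivalently, by (14.14.1) on the pin, `D.H2/T·D.H2` is finite —
`KatoDescentDatumPinH2.finite_coinvariants_H2_iff_finite_descentCokernel`), then `ι[D.z] ∈ H¹(ℤ[1/p], T_pW)` is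
not `ℤ_p`-torsion. The tree's generator lemma
(`IwasawaAlgebra.exists_forall_pow_smul_mkQ_ne_zero_of_span_pow_mul_charIdeal_eq`, `G = {z}`) and the
injectivity of `ι`; this is GEN 2's `KatoZeta.forall_pow_smul_iota_zeta_ne_zero` moved onto the pin so that
this file imports no `Theses`-importing module. [cite: BurungaleTian2026, Thm. 3.1 (proof, p. 6: (3.1)–(3.2))]
[cite: Kato2004Asterisque, Conj. 12.10 (p. 224) and §14.14 (14.14.1) (p. 243)] -/
theorem forall_pow_smul_iota_ne_zero_of_pinH2 (P : KatoDescentDatumPinH2 W p D)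
    (hK : ∃ a b : ℕ,
      Ideal.span {(p : IwasawaAlgebra p) ^ a} * Module.charIdeal (IwasawaAlgebra p) D.H2 =
        Ideal.span {(p : IwasawaAlgebra p) ^ b} *
          Module.charIdeal (IwasawaAlgebra p) (D.H ⧸ (IwasawaAlgebra p) ∙ D.z))
    (hcok : Finite (IwasawaH1Data.descentCokernel P.I)) :
    ∀ m : ℕ, p ^ m • D.ι (Submodule.Quotient.mk D.z) ≠ 0 := by
  have hfin : Finite (coinvariants p D.H2) :=
    P.finite_coinvariants_H2_iff_finite_descentCokernel.mpr hcok
  have hG : ∃ g ∈ ({D.z} : Set D.H), g ≠ 0 := ⟨D.z, Set.mem_singleton _, D.z_ne_zero⟩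
  obtain ⟨g, hg, h⟩ :=
    IwasawaAlgebra.exists_forall_pow_smul_mkQ_ne_zero_of_span_pow_mul_charIdeal_eq p hG
      D.isTorsion_quotient D.isTorsion_H2 hK hfin
  rw [Set.mem_singleton_iff] at hg
  subst hg
  intro m hm
  refine h m (D.ι_injective ?_)
  rw [map_nsmul, hm, map_zero]

/-- **`L(E,1) ≠ 0` from a finite `Sel_{p^∞}(E/ℚ)` on a v2-PINNED Kato descent datum** (any `E/ℚ`, any `p`,
any reduction type; Burungale–Tian Thm. 3.1 / Remark 3.2). Inputs at the pin `P`: (3.1) `hcok` — `Sel_{p^∞}`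
finite ⟹ the PINNED descent cokernel `H¹(ℤ[1/p], T_pW)/proj₀(𝐇¹_Γ/T)` is finite [Kato (14.9.3) +
(14.14.1)–(14.14.2), pattern of 14.13]; (VAN) `hvan` at the datum [for Kato's zeta element: Thm. 12.5 (1),
`H¹(ℚ_ℓ, V) = 0` (`ℓ ≠ p`), `H¹_f(ℚ, V) = 0`; the source's (3.3)]; (K) `hK` the main-conjecture-type
relation of `D.z`. [cite: BurungaleTian2026, Thm. 3.1 (proof, p. 6) and Remark 3.2]
[cite: Kato2004Asterisque, Thm. 12.5 (1) (p. 222), (14.9.3) (p. 240) and §14.14 (14.14.1)–(14.14.2) (p. 243)] -/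
theorem entireLFunction_one_ne_zero_of_pinH2 (P : KatoDescentDatumPinH2 W p D)
    (hcok : Finite (W.selmerGroupPInfty p) → Finite (IwasawaH1Data.descentCokernel P.I))
    (hvan : Finite (W.selmerGroupPInfty p) → W.entireLFunction 1 = 0 →
      ∃ n : ℕ, p ^ n • D.ι (Submodule.Quotient.mk D.z) = 0)
    (hK : ∃ a b : ℕ,
      Ideal.span {(p : IwasawaAlgebra p) ^ a} * Module.charIdeal (IwasawaAlgebra p) D.H2 =
        Ideal.span {(p : IwasawaAlgebra p) ^ b} *
          Module.charIdeal (IwasawaAlgebra p) (D.H ⧸ (IwasawaAlgebra p) ∙ D.z))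
    (hfin : Finite (W.selmerGroupPInfty p)) : W.entireLFunction 1 ≠ 0 := by
  intro hL
  obtain ⟨n, hn⟩ := hvan hfin hL
  exact forall_pow_smul_iota_ne_zero_of_pinH2 W p P hK (hcok hfin) n hn

/-- **The rank-`0` `p`-converse on a v2-pinned datum**: `corank_{ℤ_p} Sel_{p^∞}(E/ℚ) = 0 ⟹ ord_{s=1} L(E,s)
= 0`, from (3.1) on the pinned descent cokernel, (VAN) and (K) at the datum (any `E/ℚ`, any `p`). The corank is
the tree's `W.selmerCorank p` (`= 0` iff `Sel_{p^∞}` finite, `finite_selmerGroupPInfty_iff_selmerCorank_eq_zero`);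
`r_an = 0` from `L(E,1) ≠ 0` needs no continuation (`analyticRank_eq_zero_of_entireLFunction_one_ne_zero`).
[cite: BurungaleTian2026, Thm. 1.1, Thm. 3.1 and Remark 3.2] -/
theorem analyticRank_eq_zero_of_pinH2 (P : KatoDescentDatumPinH2 W p D)
    (hcok : Finite (W.selmerGroupPInfty p) → Finite (IwasawaH1Data.descentCokernel P.I))
    (hvan : Finite (W.selmerGroupPInfty p) → W.entireLFunction 1 = 0 →
      ∃ n : ℕ, p ^ n • D.ι (Submodule.Quotient.mk D.z) = 0)
    (hK : ∃ a b : ℕ,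
      Ideal.span {(p : IwasawaAlgebra p) ^ a} * Module.charIdeal (IwasawaAlgebra p) D.H2 =
        Ideal.span {(p : IwasawaAlgebra p) ^ b} *
          Module.charIdeal (IwasawaAlgebra p) (D.H ⧸ (IwasawaAlgebra p) ∙ D.z))
    (h0 : W.selmerCorank p = 0) : W.analyticRank = 0 :=
  analyticRank_eq_zero_of_entireLFunction_one_ne_zero W
    (entireLFunction_one_ne_zero_of_pinH2 W p P hcok hvan hK
      ((finite_selmerGroupPInfty_iff_selmerCorank_eq_zero W p).2 h0))

/-- **Contrapositive on a pin (the shape feeding Goldfeld-type statements, B–T §1.0.3):** with (3.1), (VAN),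
(K) at a v2-pinned datum, `L(E,1) = 0 ⟹ corank_{ℤ_p} Sel_{p^∞}(E/ℚ) ≥ 1`.
[cite: BurungaleTian2026, Thm. 1.1 and §1.0.3] -/
theorem one_le_selmerCorank_of_entireLFunction_one_eq_zero_of_pinH2 (P : KatoDescentDatumPinH2 W p D)
    (hcok : Finite (W.selmerGroupPInfty p) → Finite (IwasawaH1Data.descentCokernel P.I))
    (hvan : Finite (W.selmerGroupPInfty p) → W.entireLFunction 1 = 0 →
      ∃ n : ℕ, p ^ n • D.ι (Submodule.Quotient.mk D.z) = 0)
    (hK : ∃ a b : ℕ,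
      Ideal.span {(p : IwasawaAlgebra p) ^ a} * Module.charIdeal (IwasawaAlgebra p) D.H2 =
        Ideal.span {(p : IwasawaAlgebra p) ^ b} *
          Module.charIdeal (IwasawaAlgebra p) (D.H ⧸ (IwasawaAlgebra p) ∙ D.z))
    (hL : W.entireLFunction 1 = 0) : 1 ≤ W.selmerCorank p := by
  by_contra h
  have h0 : W.selmerCorank p = 0 := by omega
  exact entireLFunction_one_ne_zero_of_pinH2 W p P hcok hvan hK
    ((finite_selmerGroupPInfty_iff_selmerCorank_eq_zero W p).2 h0) hL

end OnePin

/-! ## §2 The ∀-closed bridges at `p = 2`: (R) and (K) discharged, research object = (VAN-K) -/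

section Route

/-- **REDUCTION-TYPE-FREE rank-`0` `2`-converse for non-CM `E/ℚ` on the PINNED Kato–zeta road.** Displayed
inputs: Kato's three CONSTRUCTION facts `h1 = Kato2004.nonempty_iwasawaH1Data` [(12.2.1)],
`h2 = Kato2004.nonempty_iwasawaH2Data` [Thm. 12.4 (1), (14.14.1)], `h12 = Kato2004.thm12_4` [Thm. 12.4 (2)]
(they give, for every `W`, a v2-pinned datum WITH the relation (K) — `readingRK_of_facts'`, module algebra);
the PRINT reading (3.1) at `p = 2` on PINNED objects `h31` (`Sel_{2^∞}(E/ℚ)` finite ⟹ the descent cokernel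
`H¹(ℤ[1/2], T₂E)/proj₀(𝐇¹_Γ/T)` finite [Kato (14.9.3), "exact up to ×2 in the case p = 2" — ranks
unaffected — with (14.14.1)–(14.14.2), pattern 14.13; rank-`0` twin of the accepted fact
`Kato2004.finite_descentCokernel_of_rankOne`]); and the ONE research object `hvan` = (VAN-K) for every non-CM
`W`: on every v2-pinned datum with (K), `Sel_{2^∞}` finite ∧ `L(E,1) = 0 ⟹ ι[z]` torsion [PRINT for Kato's
zeta element: Thm. 12.5 (1); for pinned `z` with (K) it is Kato's Conj. 12.10 ⊗ ℚ₂ at `(T)` — OPEN for non-CM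
`f` at `2`, Burungale–Tian p. 3]. Conclusion: every non-CM `E/ℚ`, whatever its reduction at `2`, has
`corank Sel_{2^∞}(E/ℚ) = 0 ⟹ ord_{s=1} L(E,s) = 0`. Nothing asserted; closes nothing by itself.
[cite: BurungaleTian2026, Thm. 3.1, Remark 3.2 and §1.0.3 (p. 3)]
[cite: Kato2004Asterisque, §12.2 (12.2.1) (p. 220), Thm. 12.4 (p. 221), Thm. 12.5 (1) (p. 222), Conj. 12.10 (p. 224), (14.9.3) (p. 240), §14.14 (p. 243)] -/
theorem nonCM_rankZero_twoConverse_of_vanK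
    (h1 : nonempty_iwasawaH1Data) (h2 : nonempty_iwasawaH2Data) (h12 : thm12_4)
    (h31 : ∀ (W : WeierstrassCurve ℚ) [W.IsElliptic] [ContinuousSMul ℤ_[2] (W.tateModule 2)]
      (κ : ZpExtension ℚ 2) (γ : absoluteGaloisGroup ℚ), κ.IsCyclotomic → κ.IsTopGenerator γ →
      ∀ I : IwasawaH1Data W 2 κ γ, Finite (W.selmerGroupPInfty 2) →
        Finite (IwasawaH1Data.descentCokernel I))
    (hvan : ∀ (W : WeierstrassCurve ℚ) [W.IsElliptic] [W.IsGloballyMinimal], ¬ W.HasCM →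
      ∀ D : KatoDescentDatum 2, IsKatoDescentDatumOfH2 W 2 D →
        (∃ a b : ℕ,
          Ideal.span {((2 : ℕ) : IwasawaAlgebra 2) ^ a} * Module.charIdeal (IwasawaAlgebra 2) D.H2 =
            Ideal.span {((2 : ℕ) : IwasawaAlgebra 2) ^ b} *
              Module.charIdeal (IwasawaAlgebra 2) (D.H ⧸ (IwasawaAlgebra 2) ∙ D.z)) →
        Finite (W.selmerGroupPInfty 2) → W.entireLFunction 1 = 0 →
          ∃ n : ℕ, 2 ^ n • D.ι (Submodule.Quotient.mk D.z) = 0) :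
    ∀ (W : WeierstrassCurve ℚ) [W.IsElliptic] [W.IsGloballyMinimal],
      ¬ W.HasCM → W.selmerCorank 2 = 0 → W.analyticRank = 0 := by
  intro W _ _ hcm h0
  letI : ContinuousSMul ℤ_[2] (W.tateModule 2) := TateModule.continuousSMul_padicInt
  obtain ⟨D, ⟨P⟩, a, b, hab⟩ := readingRK_of_facts' h1 h2 h12 W 2
  exact analyticRank_eq_zero_of_pinH2 W 2 P
    (fun hfin => h31 W P.κ P.γ P.isCyclotomic P.isTopGenerator P.I hfin)
    (hvan W hcm D (isKatoDescentDatumOfH2_of_pin P) ⟨a, b, hab⟩) ⟨a, b, hab⟩ h0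

/-- **Bridge to the crux `MultiplicativeRankZeroTwoConverse` (item stmt-BirchSwinnertonDyer-19219) on the
PINNED Kato–zeta road** — construction facts + (3.1) at `2` + (VAN-K) on the MULTIPLICATIVE branch only ⟹
the FULLY-QUALIFIED route decl. Compared with GEN 2's `multiplicativeRankZeroTwoConverse_of_katoMainConjectureRat`
(free `IsOf`, four schemata): (R) is now `readingRK_of_facts'`/`exists_isKatoDescentDatumOfH2` and (MC) is
realised by the choice of `z`; compared with the cyclotomic road (`…_of_multEisenstein`, `…_of_wallsS3`): no
`p`-adic `L`-function, no A235/A236, no Spieß/Greenberg–Stevens, no period, no K11, no split/non-split cases.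
Nothing asserted; closes nothing by itself. [cite: BurungaleTian2026, Thm. 3.1 and Remark 3.2]
[cite: Kato2004Asterisque, Thm. 12.4 (p. 221), Thm. 12.5 (1) (p. 222), Conj. 12.10 (p. 224), (14.9.3) (p. 240), §14.14 (p. 243)] -/
theorem multiplicativeRankZeroTwoConverse_of_vanK
    (h1 : nonempty_iwasawaH1Data) (h2 : nonempty_iwasawaH2Data) (h12 : thm12_4)
    (h31 : ∀ (W : WeierstrassCurve ℚ) [W.IsElliptic] [ContinuousSMul ℤ_[2] (W.tateModule 2)]
      (κ : ZpExtension ℚ 2) (γ : absoluteGaloisGroup ℚ), κ.IsCyclotomic → κ.IsTopGenerator γ →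
      ∀ I : IwasawaH1Data W 2 κ γ, Finite (W.selmerGroupPInfty 2) →
        Finite (IwasawaH1Data.descentCokernel I))
    (hvan : ∀ (W : WeierstrassCurve ℚ) [W.IsElliptic] [W.IsGloballyMinimal], ¬ W.HasCM → Mult W 2 →
      ∀ D : KatoDescentDatum 2, IsKatoDescentDatumOfH2 W 2 D →
        (∃ a b : ℕ,
          Ideal.span {((2 : ℕ) : IwasawaAlgebra 2) ^ a} * Module.charIdeal (IwasawaAlgebra 2) D.H2 =
            Ideal.span {((2 : ℕ) : IwasawaAlgebra 2) ^ b} *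
              Module.charIdeal (IwasawaAlgebra 2) (D.H ⧸ (IwasawaAlgebra 2) ∙ D.z)) →
        Finite (W.selmerGroupPInfty 2) → W.entireLFunction 1 = 0 →
          ∃ n : ℕ, 2 ^ n • D.ι (Submodule.Quotient.mk D.z) = 0) :
    Summit.BirchSwinnertonDyer.BirchSwinnertonDyer.Theses.TwoAdicConverse.MultiplicativeRankZeroTwoConverse := by
  unfold Summit.BirchSwinnertonDyer.BirchSwinnertonDyer.Theses.TwoAdicConverse.MultiplicativeRankZeroTwoConverse
  intro W _ _ hcm hmult h0
  letI : ContinuousSMul ℤ_[2] (W.tateModule 2) := TateModule.continuousSMul_padicInt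
  obtain ⟨D, ⟨P⟩, a, b, hab⟩ := readingRK_of_facts' h1 h2 h12 W 2
  exact analyticRank_eq_zero_of_pinH2 W 2 P
    (fun hfin => h31 W P.κ P.γ P.isCyclotomic P.isTopGenerator P.I hfin)
    (hvan W hcm hmult D (isKatoDescentDatumOfH2_of_pin P) ⟨a, b, hab⟩) ⟨a, b, hab⟩ h0

/-- **Bridge to the crux `GoodOrdinaryRankZeroTwoConverse` (item stmt-BirchSwinnertonDyer-19218) on the PINNED
Kato–zeta road** — the good-ordinary twin: construction facts + (3.1) at `2` + (VAN-K) on the good-ordinary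
branch ⟹ the route decl. The rational `2`-torsion point of every good-ordinary curve at `2` (route «why it might
fail» for 19218) plays no role: the road is insensitive to `E[2]`.
[cite: BurungaleTian2026, Thm. 3.1 and Remark 3.2] [cite: Kato2004Asterisque, Conj. 12.10 (p. 224) and §14.14 (p. 243)] -/
theorem goodOrdinaryRankZeroTwoConverse_of_vanK
    (h1 : nonempty_iwasawaH1Data) (h2 : nonempty_iwasawaH2Data) (h12 : thm12_4)
    (h31 : ∀ (W : WeierstrassCurve ℚ) [W.IsElliptic] [ContinuousSMul ℤ_[2] (W.tateModule 2)]
      (κ : ZpExtension ℚ 2) (γ : absoluteGaloisGroup ℚ), κ.IsCyclotomic → κ.IsTopGenerator γ →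
      ∀ I : IwasawaH1Data W 2 κ γ, Finite (W.selmerGroupPInfty 2) →
        Finite (IwasawaH1Data.descentCokernel I))
    (hvan : ∀ (W : WeierstrassCurve ℚ) [W.IsElliptic] [W.IsGloballyMinimal], ¬ W.HasCM → GoodOrd W 2 →
      ∀ D : KatoDescentDatum 2, IsKatoDescentDatumOfH2 W 2 D →
        (∃ a b : ℕ,
          Ideal.span {((2 : ℕ) : IwasawaAlgebra 2) ^ a} * Module.charIdeal (IwasawaAlgebra 2) D.H2 =
            Ideal.span {((2 : ℕ) : IwasawaAlgebra 2) ^ b} *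
              Module.charIdeal (IwasawaAlgebra 2) (D.H ⧸ (IwasawaAlgebra 2) ∙ D.z)) →
        Finite (W.selmerGroupPInfty 2) → W.entireLFunction 1 = 0 →
          ∃ n : ℕ, 2 ^ n • D.ι (Submodule.Quotient.mk D.z) = 0) :
    Summit.BirchSwinnertonDyer.BirchSwinnertonDyer.Theses.TwoAdicConverse.GoodOrdinaryRankZeroTwoConverse := by
  unfold Summit.BirchSwinnertonDyer.BirchSwinnertonDyer.Theses.TwoAdicConverse.GoodOrdinaryRankZeroTwoConverse
  intro W _ _ hcm hord h0
  letI : ContinuousSMul ℤ_[2] (W.tateModule 2) := TateModule.continuousSMul_padicInt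
  obtain ⟨D, ⟨P⟩, a, b, hab⟩ := readingRK_of_facts' h1 h2 h12 W 2
  exact analyticRank_eq_zero_of_pinH2 W 2 P
    (fun hfin => h31 W P.κ P.γ P.isCyclotomic P.isTopGenerator P.I hfin)
    (hvan W hcm hord D (isKatoDescentDatumOfH2_of_pin P) ⟨a, b, hab⟩) ⟨a, b, hab⟩ h0

/-- **Both rank-`0` cruxes of route S3 at once on the PINNED road**: construction facts + (3.1) at `2` +
(VAN-K) on the leaf's own scope (non-CM, good ordinary OR multiplicative at `2`) ⟹
`GoodOrdinaryRankZeroTwoConverse ∧ MultiplicativeRankZeroTwoConverse` — the whole `r = 0` layer of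
`NonCMTwoConverse` below the declared residual `RankOneTwoConverse` hinges on ONE ∀-object over pinned data.
[cite: BurungaleTian2026, Thm. 3.1 and Remark 3.2] -/
theorem rankZero_twoConverse_cruxes_of_vanK
    (h1 : nonempty_iwasawaH1Data) (h2 : nonempty_iwasawaH2Data) (h12 : thm12_4)
    (h31 : ∀ (W : WeierstrassCurve ℚ) [W.IsElliptic] [ContinuousSMul ℤ_[2] (W.tateModule 2)]
      (κ : ZpExtension ℚ 2) (γ : absoluteGaloisGroup ℚ), κ.IsCyclotomic → κ.IsTopGenerator γ →
      ∀ I : IwasawaH1Data W 2 κ γ, Finite (W.selmerGroupPInfty 2) →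
        Finite (IwasawaH1Data.descentCokernel I))
    (hvan : ∀ (W : WeierstrassCurve ℚ) [W.IsElliptic] [W.IsGloballyMinimal], ¬ W.HasCM →
      (GoodOrd W 2 ∨ Mult W 2) →
      ∀ D : KatoDescentDatum 2, IsKatoDescentDatumOfH2 W 2 D →
        (∃ a b : ℕ,
          Ideal.span {((2 : ℕ) : IwasawaAlgebra 2) ^ a} * Module.charIdeal (IwasawaAlgebra 2) D.H2 =
            Ideal.span {((2 : ℕ) : IwasawaAlgebra 2) ^ b} *
              Module.charIdeal (IwasawaAlgebra 2) (D.H ⧸ (IwasawaAlgebra 2) ∙ D.z)) →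
        Finite (W.selmerGroupPInfty 2) → W.entireLFunction 1 = 0 →
          ∃ n : ℕ, 2 ^ n • D.ι (Submodule.Quotient.mk D.z) = 0) :
    Summit.BirchSwinnertonDyer.BirchSwinnertonDyer.Theses.TwoAdicConverse.GoodOrdinaryRankZeroTwoConverse ∧
      Summit.BirchSwinnertonDyer.BirchSwinnertonDyer.Theses.TwoAdicConverse.MultiplicativeRankZeroTwoConverse :=
  ⟨goodOrdinaryRankZeroTwoConverse_of_vanK h1 h2 h12 h31
      (fun W _ _ hcm hord D hD hK => hvan W hcm (Or.inl hord) D hD hK),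
    multiplicativeRankZeroTwoConverse_of_vanK h1 h2 h12 h31
      (fun W _ _ hcm hmult D hD hK => hvan W hcm (Or.inr hmult) D hD hK)⟩

end Route


/-! ## §3 (APPEND, GEN 10) The bridges with reading (3.1) at `2` supplied BY NAME: the Literature fact
`Kato2004.finite_descentCokernel_of_finite_selmer` (rank-`0` twin of `finite_descentCokernel_of_rankOne`) -/

section RouteOfFacts

/-- **Item 19219 on the PINNED Kato–zeta road, every displayed input a NAMED fact except the ONE research
object (VAN-K).** Kato's construction facts `nonempty_iwasawaH1Data`, `nonempty_iwasawaH2Data`, `thm12_4`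
[(12.2.1), Thm. 12.4 (1)(2), (14.14.1)] + the PRINT reading `finite_descentCokernel_of_finite_selmer`
[(14.9.3) + (14.14.1)–(14.14.2) in the finite-`Sel` case; Burungale–Tian (3.1)] + (VAN-K) on the multiplicative
branch ⟹ `MultiplicativeRankZeroTwoConverse`. (`multiplicativeRankZeroTwoConverse_of_vanK` with `h31` :=
the fact read at `p = 2`.) Nothing asserted; closes nothing by itself.
[cite: BurungaleTian2026, Thm. 3.1 and Remark 3.2] [cite: Kato2004Asterisque, Thm. 12.4 (p. 221), (14.9.3) (p. 240), §14.14 (p. 243)] -/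
theorem multiplicativeRankZeroTwoConverse_of_vanK_of_facts
    (h1 : nonempty_iwasawaH1Data) (h2 : nonempty_iwasawaH2Data) (h12 : thm12_4)
    (h31 : finite_descentCokernel_of_finite_selmer)
    (hvan : ∀ (W : WeierstrassCurve ℚ) [W.IsElliptic] [W.IsGloballyMinimal], ¬ W.HasCM → Mult W 2 →
      ∀ D : KatoDescentDatum 2, IsKatoDescentDatumOfH2 W 2 D →
        (∃ a b : ℕ,
          Ideal.span {((2 : ℕ) : IwasawaAlgebra 2) ^ a} * Module.charIdeal (IwasawaAlgebra 2) D.H2 =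
            Ideal.span {((2 : ℕ) : IwasawaAlgebra 2) ^ b} *
              Module.charIdeal (IwasawaAlgebra 2) (D.H ⧸ (IwasawaAlgebra 2) ∙ D.z)) →
        Finite (W.selmerGroupPInfty 2) → W.entireLFunction 1 = 0 →
          ∃ n : ℕ, 2 ^ n • D.ι (Submodule.Quotient.mk D.z) = 0) :
    Summit.BirchSwinnertonDyer.BirchSwinnertonDyer.Theses.TwoAdicConverse.MultiplicativeRankZeroTwoConverse :=
  multiplicativeRankZeroTwoConverse_of_vanK h1 h2 h12
    (fun W _ _ κ γ hκ hγ I hfin => h31 W 2 κ γ hκ hγ I hfin) hvan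

/-- **Item 19218 likewise**: the three construction facts + `finite_descentCokernel_of_finite_selmer` +
(VAN-K) on the good-ordinary branch ⟹ `GoodOrdinaryRankZeroTwoConverse`.
[cite: BurungaleTian2026, Thm. 3.1 and Remark 3.2] [cite: Kato2004Asterisque, (14.9.3) (p. 240), §14.14 (p. 243)] -/
theorem goodOrdinaryRankZeroTwoConverse_of_vanK_of_facts
    (h1 : nonempty_iwasawaH1Data) (h2 : nonempty_iwasawaH2Data) (h12 : thm12_4)
    (h31 : finite_descentCokernel_of_finite_selmer)
    (hvan : ∀ (W : WeierstrassCurve ℚ) [W.IsElliptic] [W.IsGloballyMinimal], ¬ W.HasCM → GoodOrd W 2 →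
      ∀ D : KatoDescentDatum 2, IsKatoDescentDatumOfH2 W 2 D →
        (∃ a b : ℕ,
          Ideal.span {((2 : ℕ) : IwasawaAlgebra 2) ^ a} * Module.charIdeal (IwasawaAlgebra 2) D.H2 =
            Ideal.span {((2 : ℕ) : IwasawaAlgebra 2) ^ b} *
              Module.charIdeal (IwasawaAlgebra 2) (D.H ⧸ (IwasawaAlgebra 2) ∙ D.z)) →
        Finite (W.selmerGroupPInfty 2) → W.entireLFunction 1 = 0 →
          ∃ n : ℕ, 2 ^ n • D.ι (Submodule.Quotient.mk D.z) = 0) :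
    Summit.BirchSwinnertonDyer.BirchSwinnertonDyer.Theses.TwoAdicConverse.GoodOrdinaryRankZeroTwoConverse :=
  goodOrdinaryRankZeroTwoConverse_of_vanK h1 h2 h12
    (fun W _ _ κ γ hκ hγ I hfin => h31 W 2 κ γ hκ hγ I hfin) hvan

/-- **The reduction-type-free statement likewise**: four named facts + (VAN-K) for every non-CM `W` ⟹ the
rank-`0` `2`-converse for every non-CM `E/ℚ`, whatever its reduction at `2`.
[cite: BurungaleTian2026, Thm. 3.1, Remark 3.2 and §1.0.3 (p. 3)] [cite: Kato2004Asterisque, (14.9.3) (p. 240), §14.14 (p. 243)] -/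
theorem nonCM_rankZero_twoConverse_of_vanK_of_facts
    (h1 : nonempty_iwasawaH1Data) (h2 : nonempty_iwasawaH2Data) (h12 : thm12_4)
    (h31 : finite_descentCokernel_of_finite_selmer)
    (hvan : ∀ (W : WeierstrassCurve ℚ) [W.IsElliptic] [W.IsGloballyMinimal], ¬ W.HasCM →
      ∀ D : KatoDescentDatum 2, IsKatoDescentDatumOfH2 W 2 D →
        (∃ a b : ℕ,
          Ideal.span {((2 : ℕ) : IwasawaAlgebra 2) ^ a} * Module.charIdeal (IwasawaAlgebra 2) D.H2 =
            Ideal.span {((2 : ℕ) : IwasawaAlgebra 2) ^ b} *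
              Module.charIdeal (IwasawaAlgebra 2) (D.H ⧸ (IwasawaAlgebra 2) ∙ D.z)) →
        Finite (W.selmerGroupPInfty 2) → W.entireLFunction 1 = 0 →
          ∃ n : ℕ, 2 ^ n • D.ι (Submodule.Quotient.mk D.z) = 0) :
    ∀ (W : WeierstrassCurve ℚ) [W.IsElliptic] [W.IsGloballyMinimal],
      ¬ W.HasCM → W.selmerCorank 2 = 0 → W.analyticRank = 0 :=
  nonCM_rankZero_twoConverse_of_vanK h1 h2 h12
    (fun W _ _ κ γ hκ hγ I hfin => h31 W 2 κ γ hκ hγ I hfin) hvan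

end RouteOfFacts

end Summit.BirchSwinnertonDyer.BirchSwinnertonDyer.Theorems.TwoAdicKatoZetaPinned

end
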